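import Literature.Geometry.Kaehler.ComplexTorusHilbertModularCuspStabilizerTopDegreeVanishing
import Literature.Geometry.Kaehler.TranslationHomotopy
import HarnessLib

/-!
# Freitag, *Hilbert Modular Forms*, Ch. III §2 (Prop. 2.1, «`Hⁿ/Γ_∞ ≈ (D/Γ_∞) × ℝ`»): the dilations `y ↦ e^ℓ ⊙ y` act
# trivially on `H^•((ℍⁿ, Γ_∞))` — every closed `Γ_∞`-invariant form differs from its dilate by `d` of a `Γ_∞`-invariant form

Layer `Literature/Geometry/Kaehler`, namespace `Literature.NumberTheory.Automorphic.HilbertModular`; lane `lit-hodgefound`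
(Track 2 foundations), seat `lit-hodgefound-p28`, row g35-#5 — over `…CuspStabilizerTopDegreeVanishing` (the coordinates
`Θ(w) = Re w + i e^{Im w}` = `expIm`, `Θ⁻¹ = logIm`, the flow `imFlow`) and the tree's straight-line homotopy operator of a
translation `Literature.Geometry.Kaehler.transOperator` (`TranslationHomotopy`: `P_a ω x = ∫₀¹ ι_a ω (x + ta) dt`,
`ω(x + a) − ω(x) = d(P_a ω)(x)` for closed smooth `ω`, Bott–Tu §I.4).

Source. E. Freitag, *Hilbert Modular Forms*, Springer (1990), Ch. III §2, pp. 143–144 (held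
`book:freitag1990-hilbert-modular-forms`, chunk p0086): Prop. 2.1 computes `H^m(Γ_∞)`; its proof starts from «`Hⁿ/Γ_∞ ≈ (D/Γ_∞) × ℝ`,
`D = {z ∈ Hⁿ | Ny = 1}`» and the Künneth ∕ homotopy invariance of de Rham cohomology, and Ch. I §2 Lemma 2.10₁, p. 31 (the
coordinates `log y`, in which `Γ_∞` acts by AFFINE maps: translations `x ↦ x + a` and multipliers `(x, u) ↦ (ε²x + εb, u + log ε²)`).
R. Bott, L. W. Tu, *Differential Forms in Algebraic Topology* (1982), §I.4, Cor. 4.1.2 (homotopic maps induce the same map in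
cohomology; the homotopy operator of a translation).

## What is formalised (a step of the GENERATION half of Prop. 2.1, for successors; no Hodge theory)

In the coordinates `w = x + iu = Θ⁻¹(z)` (`y = e^u`) the componentwise dilations `δ_ℓ : x + iy ↦ x + i e^ℓ ⊙ y` (`ℓ ∈ ℝ^{Hom(F,ℝ)}`;
the diagonal `ℓ = r𝟙` is the flow `imFlow r` of `…TopDegreeVanishing`) are the TRANSLATIONS `w ↦ w + iℓ`, and they commute with
`Γ_∞` (whose elements `(ε m; 0 ε⁻¹)` become the affine maps `logAct ε m`, with linear part fixing `iℓ`). Hence, transporting the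
tree's translation homotopy through `Θ`:

* §1 the pullback `pullForm Φ ω (w) = ω(Φ w) ∘ DΦ(w)` of a form along a smooth self-map of `ℂ^{Hom(F,ℝ)}` (chain rule
  `pullForm (Ψ ∘ Φ) = pullForm Φ ∘ pullForm Ψ`, `d ∘ pullForm = pullForm ∘ d` = Mathlib's `extDeriv_pullback`, smoothness);
* §2 the transports `logForm ω = Θ^*ω` (a form on all of `ℂ^{Hom(F,ℝ)}`, smooth when `ω` is smooth on `ℍⁿ`) and
  `expForm Θ' = (Θ⁻¹)^*Θ'` (on `ℍⁿ`, cut to `0` off it), inverse to each other on `ℍⁿ`, commuting with `d`;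
* §3 `Γ_∞` in the coordinates `w`: `(ε m; 0 ε⁻¹) ∘ Θ = Θ ∘ logAct ε m`, `logAct ε m (w) = (ε²x + εm) + i(u + log ε²)` affine with
  linear part `logActL ε` fixing the imaginary vectors `iℓ`; a `Γ_∞`-invariant `ω` has a `logAct`-invariant transport `Θ^*ω`;
* §4 the homotopy operator `P_{iℓ}` commutes with the pullback along every affine map whose linear part fixes `iℓ`
  (`transOperator_pullForm_affine`), so `P_{iℓ}(Θ^*ω)` is again `logAct`-invariant;
* §5 **the theorem**: for `ω ∈ C^{k+1}((ℍⁿ, Γ_∞))` and every `ℓ`,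
  **`δ_ℓ^*ω − ω = d η_ℓ` with `η_ℓ = (Θ⁻¹)^* P_{iℓ} (Θ^*ω) ∈ M^k_∞(ℍⁿ)^{Γ_∞}`** (`dilPullback_sub_eq_extD`,
  `expForm_transOperator_mem_invariantForms`), hence **`δ_ℓ^*ω − ω ∈ B^{k+1}((ℍⁿ, Γ_∞))`, `δ_ℓ^*ω ∈ C^{k+1}` and
  `[δ_ℓ^*ω] = [ω]` in `H^{k+1}((ℍⁿ, Γ_∞))`** (`dilPullback_sub_mem_exactForms`, `mk_dilPullback_eq`), for every `Γ ≤ SL₂(F)`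
  (no cusp hypothesis is needed: every element of `Γ_∞` is upper triangular).

This is the «`× ℝ`» (and, for `ℓ` in the hyperplane `Σℓ = 0`, the torus-direction) homotopy invariance behind Prop. 2.1; the
remaining step of the generation statement (averaging over the `x`-torus `ℝⁿ/𝔱` equivariantly for the multipliers) is NOT
formalised here. Definitions with bodies (`pullForm`, `logForm`, `expForm`, `logAct`, `logActL`, `imagVec`, `dilateL`,
`dilPullback`); theorems otherwise; no named facts (net debt 0); no instances, no notation.

## References

* [Freitag1990] E. Freitag, *Hilbert Modular Forms*, Springer-Verlag (1990), Ch. III §2 Prop. 2.1 and proof, pp. 143–144;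
  Ch. I §2 Lemma 2.10₁, p. 31.
* [BottTu1982Forms] R. Bott, L. W. Tu, *Differential Forms in Algebraic Topology* (1982), §I.4 (Poincaré lemma, homotopy
  operator, Cor. 4.1.2).
-/

set_option maxSynthPendingDepth 3

noncomputable section

open scoped Matrix MatrixGroups Topology ContDiff Classical
open Set Filter Function MeasureTheory intervalIntegral

namespace Literature.NumberTheory.Automorphic.HilbertModular

open _root_.NumberField _root_.Complex
open Literature.Geometry.Kaehler (transOperator transIntegrand contDiff_transOperator continuous_transIntegrand_left
  sub_eq_extDeriv_transOperator)
open Literature.Geometry.Kaehler.ComplexTorus.HilbertModularFamily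

variable {F : Type*} [Field F] [NumberField F] {p k : ℕ}

/-! ## §1 Pullback of forms along smooth self-maps of `ℂ^{Hom(F,ℝ)}` -/

section Pull

/-- **Pullback of a `p`-form along a self-map `Φ` of `ℂ^{Hom(F,ℝ)}`**: `(Φ^*ω)(w) = ω(Φ w) ∘ DΦ(w)` (real derivative); for
`Φ = (z ↦ Mz)` this is the tree's `moebPullback M`. [cite: BottTu1982Forms, §I.4 (functoriality of forms); Freitag1990, Ch. III §2,
p. 142] -/
def pullForm (Φ : Point F → Point F) (α : Form F p) : Form F p := fun w ↦
  (α (Φ w)).compContinuousLinearMap (fderiv ℝ Φ w)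

omit [NumberField F] in
/-- Unfolding `pullForm`. [cite: BottTu1982Forms, §I.4] -/
theorem pullForm_apply_eq (Φ : Point F → Point F) (α : Form F p) (w : Point F) :
    pullForm Φ α w = (α (Φ w)).compContinuousLinearMap (fderiv ℝ Φ w) :=
  rfl

omit [NumberField F] in
/-- `(Φ^*ω)(w)(v) = ω(Φw)(DΦ(w)v_1, …)`. [cite: BottTu1982Forms, §I.4] -/
@[simp]
theorem pullForm_apply (Φ : Point F → Point F) (α : Form F p) (w : Point F) (v : Fin p → Point F) :
    pullForm Φ α w v = α (Φ w) fun i ↦ fderiv ℝ Φ w (v i) :=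
  rfl

omit [NumberField F] in
/-- `moebPullback M = pullForm (z ↦ Mz)`. [cite: Freitag1990, Ch. III §2, p. 142] -/
theorem moebPullback_eq_pullForm (M : SL(2, F)) (α : Form F p) : moebPullback M α = pullForm (moeb M) α :=
  rfl

omit [NumberField F] in
/-- `pullForm` is additive in the form. [cite: BottTu1982Forms, §I.4] -/
theorem pullForm_sub (Φ : Point F → Point F) (α ω' : Form F p) :
    pullForm Φ (α - ω') = pullForm Φ α - pullForm Φ ω' := by
  funext w; ext v; simp

omit [NumberField F] in
/-- `Φ^* 0 = 0`. [cite: BottTu1982Forms, §I.4] -/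
@[simp]
theorem pullForm_zero (Φ : Point F → Point F) : pullForm Φ (0 : Form F p) = 0 := by
  funext w; ext v; simp

/-- **The chain rule for pullbacks: `(Ψ ∘ Φ)^*ω = Φ^*(Ψ^*ω)`** at every point where `Φ` and (at `Φ w`) `Ψ` are differentiable.
[cite: BottTu1982Forms, §I.4 (functoriality)] -/
theorem pullForm_comp {Φ Ψ : Point F → Point F} {w : Point F} (hΦ : DifferentiableAt ℝ Φ w)
    (hΨ : DifferentiableAt ℝ Ψ (Φ w)) (α : Form F p) : pullForm (Ψ ∘ Φ) α w = pullForm Φ (pullForm Ψ α) w := by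
  ext v
  simp [pullForm_apply, fderiv_comp w hΨ hΦ]

omit [NumberField F] in
/-- The pullback at `w` only depends on the germ of `Φ` at `w`. [cite: BottTu1982Forms, §I.4] -/
theorem pullForm_congr_of_eventuallyEq {Φ Φ' : Point F → Point F} {w : Point F} (h : Φ =ᶠ[𝓝 w] Φ') (α : Form F p) :
    pullForm Φ α w = pullForm Φ' α w := by
  rw [pullForm_apply_eq, pullForm_apply_eq, h.fderiv_eq, h.self_of_nhds]

/-- **`d(Φ^*ω) = Φ^*(dω)`** at `w` (`ω` differentiable at `Φ w`, `Φ` smooth at `w`; Mathlib's `extDeriv_pullback`).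
[cite: BottTu1982Forms, §I.4 («`d` commutes with pullback»)] -/
theorem extDeriv_pullForm {Φ : Point F → Point F} {α : Form F p} {w : Point F} (hω : DifferentiableAt ℝ α (Φ w))
    (hΦ : ContDiffAt ℝ ∞ Φ w) : extDeriv (pullForm Φ α) w = pullForm Φ (extDeriv α) w :=
  extDeriv_pullback hω hΦ (by
    rw [minSmoothness_of_isRCLikeNormedField]
    exact WithTop.coe_le_coe.mpr le_top)

variable (F) in
/-- The real basis `e_σ, i e_σ` of `ℂ^{Hom(F,ℝ)}` (plumbing for smoothness of operator-valued maps). [folklore] -/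
private def realBasis' : Module.Basis ((_ : F →+* ℝ) × Fin 2) ℝ (Point F) :=
  Pi.basis fun _ ↦ Complex.basisOneI

/-- `w ↦ (η ↦ η ∘ DΦ(w))` is `C^∞` on an open set where `Φ` is (checked on basis tuples, the covectors being finite-dimensional).
[cite: Freitag1990, Ch. III §2, p. 142 («`C^∞`-differential forms»)] -/
theorem contDiffOn_compContinuousLinearMapCLM_fderiv {Φ : Point F → Point F} {s : Set (Point F)} (hs : IsOpen s)
    (hΦ : ContDiffOn ℝ ∞ Φ s) :
    ContDiffOn ℝ ∞ (fun w : Point F ↦ ContinuousAlternatingMap.compContinuousLinearMapCLM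
      (ι := Fin p) (F := ℂ) (fderiv ℝ Φ w)) s := by
  haveI := finiteDimensional_continuousAlternatingMap (realBasis' F) p
  have hD : ContDiffOn ℝ ∞ (fderiv ℝ Φ) s := ((contDiffOn_infty_iff_fderiv_of_isOpen hs).1 hΦ).2
  refine contDiffOn_clm_apply.2 fun η ↦ contDiffOn_form_of_apply_basis (realBasis' F) fun J ↦ ?_
  have htuple : ContDiffOn ℝ ∞ (fun w : Point F ↦ fun i : Fin p ↦ fderiv ℝ Φ w (realBasis' F (J i))) s :=
    contDiffOn_pi.2 fun i ↦ hD.clm_apply contDiffOn_const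
  exact η.toContinuousMultilinearMap.contDiff.comp_contDiffOn htuple

/-- **`Φ^*ω` is `C^∞` on an open `s` when `Φ` is `C^∞` on `s`, maps `s` into `t`, and `ω` is `C^∞` on `t`.**
[cite: Freitag1990, Ch. III §2, p. 142; BottTu1982Forms, §I.4] -/
theorem contDiffOn_pullForm {Φ : Point F → Point F} {s t : Set (Point F)} (hs : IsOpen s) (hΦ : ContDiffOn ℝ ∞ Φ s)
    (hst : MapsTo Φ s t) {α : Form F p} (hω : ContDiffOn ℝ ∞ α t) : ContDiffOn ℝ ∞ (pullForm Φ α) s := by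
  have h1 : ContDiffOn ℝ ∞ (fun w ↦ α (Φ w)) s := hω.comp hΦ hst
  exact ((contDiffOn_compContinuousLinearMapCLM_fderiv hs hΦ).clm_apply h1).congr fun w _ ↦ rfl

end Pull

/-! ## §2 The transports `Θ^*` and `(Θ⁻¹)^*` (`Θ(w) = Re w + i e^{Im w}`) -/

section LogExp

omit [NumberField F] in
/-- `Θ⁻¹(Θ w) = w`. [cite: Freitag1990, Ch. I §2 Lemma 2.10₁, p. 31] -/
@[simp]
theorem logIm_expIm (w : Point F) : logIm (expIm w) = w := by
  funext σ
  apply Complex.ext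
  · simp only [logIm, expIm_apply_re, Complex.add_re, Complex.ofReal_re, Complex.mul_re, Complex.ofReal_im,
      Complex.I_re, Complex.I_im, mul_zero, zero_mul, sub_zero, add_zero]
  · simp only [logIm, expIm_apply_im, Real.log_exp, Complex.add_im, Complex.ofReal_im, Complex.mul_im,
      Complex.ofReal_re, Complex.I_re, Complex.I_im, mul_zero, mul_one, zero_add, add_zero]

/-- `Θ` is differentiable. [cite: Freitag1990, Ch. I §2 Lemma 2.10₁, p. 31] -/
theorem differentiable_expIm : Differentiable ℝ (expIm : Point F → Point F) :=
  (contDiff_expIm (n := ∞)).differentiable (by simp)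

/-- `Θ⁻¹` is differentiable at the points of `ℍⁿ`. [cite: Freitag1990, Ch. I §2 Lemma 2.10₁, p. 31] -/
theorem differentiableAt_logIm {z : Point F} (hz : z ∈ halfSpace F) : DifferentiableAt ℝ (logIm : Point F → Point F) z :=
  ((contDiffOn_logIm (n := ∞)).differentiableOn (by simp)).differentiableAt (isOpen_halfSpace.mem_nhds hz)

/-- `Θ⁻¹` is `C^∞` at the points of `ℍⁿ`. [cite: Freitag1990, Ch. I §2 Lemma 2.10₁, p. 31] -/
theorem contDiffAt_logIm {z : Point F} (hz : z ∈ halfSpace F) : ContDiffAt ℝ ∞ (logIm : Point F → Point F) z :=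
  contDiffOn_logIm.contDiffAt (isOpen_halfSpace.mem_nhds hz)

/-- **`DΘ(Θ⁻¹z) ∘ DΘ⁻¹(z) = id` on `ℍⁿ`** (`Θ ∘ Θ⁻¹ = id` near `z`). [cite: Freitag1990, Ch. I §2 Lemma 2.10₁, p. 31] -/
theorem fderiv_expIm_comp_fderiv_logIm {z : Point F} (hz : z ∈ halfSpace F) :
    (fderiv ℝ expIm (logIm z)).comp (fderiv ℝ logIm z) = ContinuousLinearMap.id ℝ (Point F) := by
  have hev : (expIm ∘ logIm : Point F → Point F) =ᶠ[𝓝 z] id :=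
    Filter.eventually_of_mem (isOpen_halfSpace.mem_nhds hz) fun y hy ↦ expIm_logIm hy
  rw [← fderiv_comp z (differentiable_expIm _) (differentiableAt_logIm hz), hev.fderiv_eq, fderiv_id]

/-- **`Θ^*ω`**: the transport of a form on `ℍⁿ` to the coordinates `w = x + iu` (`y = e^u`), a form on all of `ℂ^{Hom(F,ℝ)}`.
[cite: Freitag1990, Ch. I §2 Lemma 2.10₁, p. 31; Ch. III §2, p. 144] -/
def logForm (α : Form F p) : Form F p :=
  pullForm expIm α

/-- **`(Θ⁻¹)^*Θ'`** on `ℍⁿ`, cut to `0` off `ℍⁿ` (the normalisation of `invariantForms`). [cite: Freitag1990, Ch. I §2 Lemma 2.10₁,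
p. 31; Ch. III §2, p. 142] -/
def expForm (Θ' : Form F p) : Form F p :=
  (halfSpace F).indicator (pullForm logIm Θ')

omit [NumberField F] in
/-- Unfolding `logForm`. [cite: Freitag1990, Ch. I §2 Lemma 2.10₁, p. 31] -/
theorem logForm_apply_eq (α : Form F p) (w : Point F) :
    logForm α w = (α (expIm w)).compContinuousLinearMap (fderiv ℝ expIm w) :=
  rfl

omit [NumberField F] in
/-- `expForm Θ' z = (Θ⁻¹)^*Θ' (z)` for `z ∈ ℍⁿ`. [cite: Freitag1990, Ch. III §2, p. 142] -/
theorem expForm_of_mem (Θ' : Form F p) {z : Point F} (hz : z ∈ halfSpace F) :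
    expForm Θ' z = (Θ' (logIm z)).compContinuousLinearMap (fderiv ℝ logIm z) :=
  indicator_of_mem hz (pullForm logIm Θ')

omit [NumberField F] in
/-- `expForm Θ' z = 0` for `z ∉ ℍⁿ`. [cite: Freitag1990, Ch. III §2, p. 142] -/
theorem expForm_of_not_mem (Θ' : Form F p) {z : Point F} (hz : z ∉ halfSpace F) : expForm Θ' z = 0 :=
  indicator_of_notMem hz (pullForm logIm Θ')

/-- Near a point of `ℍⁿ`, `expForm Θ'` is the honest pullback along `Θ⁻¹`. [cite: Freitag1990, Ch. III §2, p. 142] -/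
theorem expForm_eventuallyEq (Θ' : Form F p) {z : Point F} (hz : z ∈ halfSpace F) :
    expForm Θ' =ᶠ[𝓝 z] pullForm logIm Θ' :=
  Filter.eventually_of_mem (isOpen_halfSpace.mem_nhds hz) fun _ hw ↦ expForm_of_mem Θ' hw

/-- **`Θ^*ω` is `C^∞` on all of `ℂ^{Hom(F,ℝ)}` when `ω` is `C^∞` on `ℍⁿ`.** [cite: Freitag1990, Ch. III §2, p. 142] -/
theorem contDiff_logForm {α : Form F p} (hω : ContDiffOn ℝ ∞ α (halfSpace F)) : ContDiff ℝ ∞ (logForm α) := by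
  rw [← contDiffOn_univ]
  exact contDiffOn_pullForm isOpen_univ contDiff_expIm.contDiffOn (fun w _ ↦ expIm_mem_halfSpace w) hω

/-- **`(Θ⁻¹)^*Θ'` is `C^∞` on `ℍⁿ` when `Θ'` is `C^∞`.** [cite: Freitag1990, Ch. III §2, p. 142] -/
theorem contDiffOn_expForm {Θ' : Form F p} (hΘ : ContDiff ℝ ∞ Θ') : ContDiffOn ℝ ∞ (expForm Θ') (halfSpace F) :=
  (contDiffOn_pullForm isOpen_halfSpace contDiffOn_logIm (mapsTo_univ _ _) hΘ.contDiffOn).congr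
    fun _ hz ↦ expForm_of_mem Θ' hz

/-- **`(Θ⁻¹)^*(Θ^*ω) = ω` on `ℍⁿ`.** [cite: Freitag1990, Ch. I §2 Lemma 2.10₁, p. 31] -/
theorem pullForm_logIm_logForm (α : Form F p) {z : Point F} (hz : z ∈ halfSpace F) :
    pullForm logIm (logForm α) z = α z := by
  ext v
  simp only [pullForm_apply, logForm, expIm_logIm hz]
  have h : (fun i ↦ fderiv ℝ expIm (logIm z) (fderiv ℝ logIm z (v i))) = v := by
    funext i
    exact congrArg (fun L : Point F →L[ℝ] Point F ↦ L (v i)) (fderiv_expIm_comp_fderiv_logIm hz)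
  rw [h]

/-- `expForm (logForm ω) z = ω z` on `ℍⁿ`. [cite: Freitag1990, Ch. I §2 Lemma 2.10₁, p. 31] -/
theorem expForm_logForm (α : Form F p) {z : Point F} (hz : z ∈ halfSpace F) : expForm (logForm α) z = α z := by
  rw [expForm_of_mem _ hz, ← pullForm_apply_eq, pullForm_logIm_logForm α hz]

/-- **`d(Θ^*ω) = Θ^*(dω)`** at `w` (`ω` differentiable at `Θ w`). [cite: BottTu1982Forms, §I.4] -/
theorem extDeriv_logForm {α : Form F p} {w : Point F} (hω : DifferentiableAt ℝ α (expIm w)) :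
    extDeriv (logForm α) w = logForm (extDeriv α) w :=
  extDeriv_pullForm hω contDiff_expIm.contDiffAt

/-- **`extD ((Θ⁻¹)^*Θ') = (Θ⁻¹)^*(dΘ')`** for smooth `Θ'`. [cite: BottTu1982Forms, §I.4; Freitag1990, Ch. III §2, p. 142] -/
theorem extD_expForm {Θ' : Form F p} (hΘ : ContDiff ℝ ∞ Θ') : extD (expForm Θ') = expForm (extDeriv Θ') := by
  funext z
  by_cases hz : z ∈ halfSpace F
  · rw [extD_of_mem _ hz, (expForm_eventuallyEq Θ' hz).extDeriv_eq, expForm_of_mem _ hz, ← pullForm_apply_eq,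
      extDeriv_pullForm ((hΘ.differentiable (by simp)) _) (contDiffAt_logIm hz)]
  · rw [extD_of_not_mem _ hz, expForm_of_not_mem _ hz]

end LogExp

/-! ## §3 `Γ_∞` in the coordinates `w`: the affine maps `logAct ε m` -/

section LogAct

/-- **`(ε m; 0 ε⁻¹)` in the coordinates `w = x + iu`: `logAct ε m (w)_σ = (σ(ε)² x_σ + σ(ε)σ(m)) + i(u_σ + log σ(ε)²)`** (affine).
[cite: Freitag1990, Ch. I §2 Lemma 2.10₁, p. 31 («`Γ_∞` acts … by translations in `log y`»); Ch. I §2 (2.1), p. 27] -/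
def logAct (e : Fˣ) (m : F) (w : Point F) : Point F := fun σ ↦
  (((σ (e : F)) ^ 2 * (w σ).re + σ (e : F) * σ m : ℝ) : ℂ) + (((w σ).im + Real.log ((σ (e : F)) ^ 2) : ℝ) : ℂ) * Complex.I

/-- The linear part of `logAct ε m`: `v ↦ σ(ε)² Re v_σ + i Im v_σ`. [cite: Freitag1990, Ch. I §2 Lemma 2.10₁, p. 31] -/
def logActL (e : Fˣ) : Point F →L[ℝ] Point F :=
  LinearMap.toContinuousLinearMap
    { toFun := fun v σ ↦ (((σ (e : F)) ^ 2 * (v σ).re : ℝ) : ℂ) + (((v σ).im : ℝ) : ℂ) * Complex.I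
      map_add' := fun v v' ↦ funext fun σ ↦ by
        simp only [Pi.add_apply, Complex.add_re, Complex.add_im, mul_add, Complex.ofReal_add]
        ring
      map_smul' := fun c v ↦ funext fun σ ↦ by
        simp only [Pi.smul_apply, Complex.real_smul, Complex.mul_re, Complex.mul_im, Complex.ofReal_re,
          Complex.ofReal_im, zero_mul, sub_zero, add_zero, RingHom.id_apply, Complex.ofReal_mul]
        ring }

/-- Unfolding `logActL`. [cite: Freitag1990, Ch. I §2 Lemma 2.10₁, p. 31] -/
theorem logActL_apply (e : Fˣ) (v : Point F) (σ : F →+* ℝ) :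
    logActL e v σ = (((σ (e : F)) ^ 2 * (v σ).re : ℝ) : ℂ) + (((v σ).im : ℝ) : ℂ) * Complex.I :=
  rfl

/-- `logAct ε m = logActL ε + logAct ε m (0)` (affine). [cite: Freitag1990, Ch. I §2 Lemma 2.10₁, p. 31] -/
theorem logAct_eq_add (e : Fˣ) (m : F) : logAct e m = fun w ↦ logActL e w + logAct e m 0 := by
  funext w σ
  simp only [logAct, Pi.add_apply, logActL_apply, Pi.zero_apply, Complex.zero_re, Complex.zero_im, mul_zero, zero_add]
  push_cast
  ring

/-- `logAct ε m` has derivative `logActL ε` everywhere. [cite: Freitag1990, Ch. I §2 Lemma 2.10₁, p. 31] -/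
theorem hasFDerivAt_logAct (e : Fˣ) (m : F) (w : Point F) : HasFDerivAt (logAct e m) (logActL e) w := by
  rw [logAct_eq_add]
  exact (logActL e).hasFDerivAt.add_const _

/-- `D(logAct ε m) = logActL ε`. [cite: Freitag1990, Ch. I §2 Lemma 2.10₁, p. 31] -/
theorem fderiv_logAct (e : Fˣ) (m : F) (w : Point F) : fderiv ℝ (logAct e m) w = logActL e :=
  (hasFDerivAt_logAct e m w).fderiv

/-- `logAct ε m` is `C^∞`. [cite: Freitag1990, Ch. I §2 Lemma 2.10₁, p. 31] -/
theorem contDiff_logAct (e : Fˣ) (m : F) {n : WithTop ℕ∞} : ContDiff ℝ n (logAct e m) := by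
  rw [logAct_eq_add]
  exact (logActL e).contDiff.add contDiff_const

omit [NumberField F] in
/-- **`(ε m; 0 ε⁻¹) ∘ Θ = Θ ∘ logAct ε m`**: in the coordinates `w` the multipliers-and-translations of `Γ_∞` are affine.
[cite: Freitag1990, Ch. I §2 Lemma 2.10₁, p. 31; Ch. I §2 (2.1), p. 27] -/
theorem moeb_upperTri_expIm (e : Fˣ) (m : F) (w : Point F) : moeb (upperTri e m) (expIm w) = expIm (logAct e m w) := by
  funext σ
  have hne : σ (e : F) ≠ 0 := (map_ne_zero σ).2 (Units.ne_zero e)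
  have hpos : 0 < (σ (e : F)) ^ 2 := by positivity
  apply Complex.ext
  · rw [moeb_upperTri_apply, expIm_apply_re]
    simp only [logAct, Complex.add_re, Complex.mul_re, Complex.ofReal_re, Complex.ofReal_im, Complex.I_re, Complex.I_im,
      mul_zero, sub_zero, mul_one, add_zero, expIm_apply_re, expIm_apply_im, ← Complex.ofReal_pow, zero_mul]
  · rw [moeb_upperTri_apply, expIm_apply_im]
    simp only [logAct, Complex.add_im, Complex.mul_im, Complex.ofReal_re, Complex.ofReal_im, Complex.I_re, Complex.I_im,
      mul_zero, zero_add, mul_one, add_zero, zero_mul, expIm_apply_re, expIm_apply_im, ← Complex.ofReal_pow]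
    rw [Real.exp_add, Real.exp_log hpos]
    ring

end LogAct

/-! ## §4 The homotopy operator `P_a` commutes with affine maps whose linear part fixes `a` -/

section Equivariance

/-- `ι_a(β ∘ L) = (ι_{La} β) ∘ L` for a covector `β` and a linear map `L`. [cite: BottTu1982Forms, §I.4] -/
theorem curryLeft_compContinuousLinearMap (β : Point F [⋀^Fin (k + 1)]→L[ℝ] ℂ) (L : Point F →L[ℝ] Point F) (a : Point F) :
    (β.compContinuousLinearMap L).curryLeft a = (β.curryLeft (L a)).compContinuousLinearMap L := by
  ext v
  simp [ContinuousAlternatingMap.compContinuousLinearMap_apply]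

/-- **`P_a (A^*Θ') = A^*(P_a Θ')` for an affine map `A = L + c` with `L a = a`** (the straight-line homotopy from `id` to the
translation `τ_a` is `A`-equivariant: `A(x + ta) = Ax + ta`). [cite: BottTu1982Forms, §I.4 (naturality of the homotopy operator)] -/
theorem transOperator_pullForm_affine {L : Point F →L[ℝ] Point F} {a : Point F} (hLa : L a = a) (c : Point F)
    {Θ' : Form F (k + 1)} (hΘ : Continuous Θ') :
    transOperator a (pullForm (fun w ↦ L w + c) Θ') = pullForm (fun w ↦ L w + c) (transOperator a Θ') := by
  have hD : ∀ w : Point F, fderiv ℝ (fun w ↦ L w + c) w = L := fun w ↦ (L.hasFDerivAt.add_const c).fderiv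
  funext x
  have h1 : ∀ t : ℝ, transIntegrand a (pullForm (fun w ↦ L w + c) Θ') (t, x) =
      ContinuousAlternatingMap.compContinuousLinearMapCLM L (transIntegrand a Θ' (t, L x + c)) := by
    intro t
    have hpt : L (x + t • a) + c = (L x + c) + t • a := by
      rw [map_add, map_smul, hLa]
      abel
    simp only [transIntegrand, pullForm_apply_eq, hD, hpt, ContinuousAlternatingMap.compContinuousLinearMapCLM_apply,
      curryLeft_compContinuousLinearMap, hLa]
  simp only [transOperator]
  simp_rw [h1]
  rw [ContinuousLinearMap.intervalIntegral_comp_comm _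
    ((continuous_transIntegrand_left a hΘ (L x + c)).intervalIntegrable _ _),
    ContinuousAlternatingMap.compContinuousLinearMapCLM_apply, pullForm_apply_eq, hD]
  rfl

end Equivariance

/-! ## §5 The dilations `δ_ℓ` act trivially on `H^•((ℍⁿ, Γ_∞))` -/

section Dilation

/-- The imaginary vector `iℓ ∈ ℂ^{Hom(F,ℝ)}` of `ℓ ∈ ℝ^{Hom(F,ℝ)}` (the translation `w ↦ w + iℓ` is `u ↦ u + ℓ`).
[cite: Freitag1990, Ch. I §2 Lemma 2.10₁, p. 31] -/
def imagVec (ℓ : (F →+* ℝ) → ℝ) : Point F := fun σ ↦ ((ℓ σ : ℝ) : ℂ) * Complex.I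

omit [NumberField F] in
/-- `Re (iℓ)_σ = 0`. [cite: Freitag1990, Ch. I §2 Lemma 2.10₁, p. 31] -/
@[simp]
theorem imagVec_apply_re (ℓ : (F →+* ℝ) → ℝ) (σ : F →+* ℝ) : (imagVec ℓ σ).re = 0 := by
  simp [imagVec]

omit [NumberField F] in
/-- `Im (iℓ)_σ = ℓ_σ`. [cite: Freitag1990, Ch. I §2 Lemma 2.10₁, p. 31] -/
@[simp]
theorem imagVec_apply_im (ℓ : (F →+* ℝ) → ℝ) (σ : F →+* ℝ) : (imagVec ℓ σ).im = ℓ σ := by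
  simp [imagVec]

/-- **The dilation `δ_ℓ : x + iy ↦ x + i e^ℓ ⊙ y`** (componentwise), a real-linear map of `ℂ^{Hom(F,ℝ)}` preserving `ℍⁿ`; the
diagonal `ℓ = r𝟙` is the flow `φ_r` (`imFlow r`). [cite: Freitag1990, Ch. III §2, p. 144 («`Hⁿ/Γ_∞ ≈ (D/Γ_∞) × ℝ`»); Ch. I §2
Lemma 2.10₁, p. 31] -/
def dilateL (ℓ : (F →+* ℝ) → ℝ) : Point F →L[ℝ] Point F :=
  LinearMap.toContinuousLinearMap
    { toFun := fun v σ ↦ (((v σ).re : ℝ) : ℂ) + ((Real.exp (ℓ σ) * (v σ).im : ℝ) : ℂ) * Complex.I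
      map_add' := fun v v' ↦ funext fun σ ↦ by
        simp only [Pi.add_apply, Complex.add_re, Complex.add_im, mul_add, Complex.ofReal_add]
        ring
      map_smul' := fun c v ↦ funext fun σ ↦ by
        simp only [Pi.smul_apply, Complex.real_smul, Complex.mul_re, Complex.mul_im, Complex.ofReal_re,
          Complex.ofReal_im, zero_mul, sub_zero, add_zero, RingHom.id_apply, Complex.ofReal_mul]
        ring }

/-- Unfolding `δ_ℓ`. [cite: Freitag1990, Ch. III §2, p. 144] -/
theorem dilateL_apply (ℓ : (F →+* ℝ) → ℝ) (v : Point F) (σ : F →+* ℝ) :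
    dilateL ℓ v σ = (((v σ).re : ℝ) : ℂ) + ((Real.exp (ℓ σ) * (v σ).im : ℝ) : ℂ) * Complex.I :=
  rfl

/-- `Re (δ_ℓ v)_σ = Re v_σ`. [cite: Freitag1990, Ch. III §2, p. 144] -/
@[simp]
theorem dilateL_apply_re (ℓ : (F →+* ℝ) → ℝ) (v : Point F) (σ : F →+* ℝ) : (dilateL ℓ v σ).re = (v σ).re := by
  rw [dilateL_apply]
  simp only [Complex.add_re, Complex.ofReal_re, Complex.mul_re, Complex.ofReal_im, Complex.I_re, Complex.I_im,
    mul_zero, zero_mul, sub_zero, add_zero]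

/-- `Im (δ_ℓ v)_σ = e^{ℓ_σ} Im v_σ`. [cite: Freitag1990, Ch. III §2, p. 144] -/
@[simp]
theorem dilateL_apply_im (ℓ : (F →+* ℝ) → ℝ) (v : Point F) (σ : F →+* ℝ) :
    (dilateL ℓ v σ).im = Real.exp (ℓ σ) * (v σ).im := by
  rw [dilateL_apply]
  simp only [Complex.add_im, Complex.ofReal_im, Complex.mul_im, Complex.ofReal_re, Complex.I_re, Complex.I_im,
    mul_zero, mul_one, zero_add, add_zero]

/-- `δ_ℓ` maps `ℍⁿ` to itself. [cite: Freitag1990, Ch. III §2, p. 144] -/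
theorem dilateL_mem_halfSpace (ℓ : (F →+* ℝ) → ℝ) {z : Point F} (hz : z ∈ halfSpace F) : dilateL ℓ z ∈ halfSpace F :=
  fun σ ↦ by rw [dilateL_apply_im]; exact mul_pos (Real.exp_pos _) (hz σ)

/-- The diagonal dilation is the flow `φ_r` of `…TopDegreeVanishing`: `δ_{r𝟙} = φ_r`. [cite: Freitag1990, Ch. III §2, p. 144] -/
theorem dilateL_const_apply (r : ℝ) (z : Point F) : dilateL (fun _ ↦ r) z = imFlow r z := by
  funext σ
  apply Complex.ext
  · rw [dilateL_apply_re, imFlow_apply_re]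
  · rw [dilateL_apply_im, imFlow_apply_im]

/-- **The dilations are translations in the coordinate `u`: `Θ(w + iℓ) = δ_ℓ(Θ w)`.** [cite: Freitag1990, Ch. I §2 Lemma 2.10₁, p. 31] -/
theorem expIm_add_imagVec (w : Point F) (ℓ : (F →+* ℝ) → ℝ) : expIm (w + imagVec ℓ) = dilateL ℓ (expIm w) := by
  funext σ
  apply Complex.ext
  · rw [expIm_apply_re, dilateL_apply_re, expIm_apply_re, Pi.add_apply, Complex.add_re, imagVec_apply_re, add_zero]
  · rw [expIm_apply_im, dilateL_apply_im, expIm_apply_im, Pi.add_apply, Complex.add_im, imagVec_apply_im, Real.exp_add,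
      mul_comm]

/-- The linear part of `logAct ε m` fixes the imaginary vectors: `L(iℓ) = iℓ`. [cite: Freitag1990, Ch. I §2 Lemma 2.10₁, p. 31] -/
theorem logActL_imagVec (e : Fˣ) (ℓ : (F →+* ℝ) → ℝ) : logActL e (imagVec ℓ) = imagVec ℓ := by
  funext σ
  rw [logActL_apply, imagVec_apply_re, imagVec_apply_im, mul_zero, Complex.ofReal_zero, zero_add]
  rfl

/-- **`δ_ℓ^*ω`** on `ℍⁿ` (cut to `0` off `ℍⁿ`): the natural action of the dilation `δ_ℓ` on `M^p_∞(ℍⁿ)`.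
[cite: Freitag1990, Ch. III §2, p. 144; BottTu1982Forms, §I.4] -/
def dilPullback (ℓ : (F →+* ℝ) → ℝ) (α : Form F p) : Form F p :=
  (halfSpace F).indicator (pullForm (dilateL ℓ) α)

/-- `δ_ℓ^*ω (z) = ω(δ_ℓ z) ∘ δ_ℓ` for `z ∈ ℍⁿ`. [cite: BottTu1982Forms, §I.4] -/
theorem dilPullback_of_mem (ℓ : (F →+* ℝ) → ℝ) (α : Form F p) {z : Point F} (hz : z ∈ halfSpace F) :
    dilPullback ℓ α z = (α (dilateL ℓ z)).compContinuousLinearMap (dilateL ℓ) := by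
  rw [dilPullback, indicator_of_mem hz (pullForm (dilateL ℓ) α), pullForm_apply_eq, (dilateL ℓ).fderiv]

/-- `δ_ℓ^*ω (z) = 0` for `z ∉ ℍⁿ`. [cite: Freitag1990, Ch. III §2, p. 142] -/
theorem dilPullback_of_not_mem (ℓ : (F →+* ℝ) → ℝ) (α : Form F p) {z : Point F} (hz : z ∉ halfSpace F) :
    dilPullback ℓ α z = 0 :=
  indicator_of_notMem hz (pullForm (dilateL ℓ) α)

variable {Γ : Subgroup SL(2, F)}

/-- **`Θ^*ω` is closed when `ω` is closed on `ℍⁿ`.** [cite: BottTu1982Forms, §I.4] -/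
theorem extDeriv_logForm_eq_zero {α : Form F p} (hα : α ∈ closedForms Γ p) : extDeriv (logForm α) = 0 := by
  have h := (mem_closedForms_iff Γ α).1 hα
  funext w
  have hw : expIm w ∈ halfSpace F := expIm_mem_halfSpace w
  rw [extDeriv_logForm (differentiableAt_of_mem_invariantForms h.1 hw), logForm_apply_eq, h.2 _ hw]
  ext v
  simp

/-- **`Θ^*ω` is `logAct`-invariant for a `Γ_∞`-invariant `ω`**: `(logAct ε m)^*(Θ^*ω) = Θ^*((ε m; 0 ε⁻¹)^*ω) = Θ^*ω`.
[cite: Freitag1990, Ch. I §2 Lemma 2.10₁, p. 31; Ch. III §2, p. 142] -/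
theorem pullForm_logAct_logForm {α : Form F p} (hα : IsInvariantForm (stabInfty Γ) α) {e : Fˣ} {m : F}
    (h : upperTri e m ∈ stabInfty Γ) : pullForm (logAct e m) (logForm α) = logForm α := by
  funext w
  have hcomp : pullForm (logAct e m) (logForm α) w = pullForm (expIm ∘ logAct e m) α w :=
    (pullForm_comp (hasFDerivAt_logAct e m w).differentiableAt (differentiable_expIm _) α).symm
  have hfun : (expIm ∘ logAct e m : Point F → Point F) = moeb (upperTri e m) ∘ expIm :=
    funext fun w ↦ (moeb_upperTri_expIm e m w).symm
  have hdm : DifferentiableAt ℝ (moeb (upperTri e m)) (expIm w) :=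
    ((hasFDerivAt_moeb _ (expIm_mem_halfSpace w)).restrictScalars ℝ).differentiableAt
  rw [hcomp, hfun, pullForm_comp (differentiable_expIm _) hdm α, ← moebPullback_eq_pullForm]
  change (moebPullback (upperTri e m) α (expIm w)).compContinuousLinearMap (fderiv ℝ expIm w) =
    (α (expIm w)).compContinuousLinearMap (fderiv ℝ expIm w)
  rw [hα _ h _ (expIm_mem_halfSpace w)]

/-- **`η_ℓ = (Θ⁻¹)^* P_{iℓ}(Θ^*ω) ∈ M^k_∞(ℍⁿ)^{Γ_∞}` for `ω ∈ M^{k+1}_∞(ℍⁿ)^{Γ_∞}`**: smooth on `ℍⁿ`, zero off it, and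
`Γ_∞`-invariant because `P_{iℓ}` commutes with the affine maps `logAct ε m` (whose linear part fixes `iℓ`) and `Θ^*ω` is
`logAct`-invariant. [cite: BottTu1982Forms, §I.4; Freitag1990, Ch. III §2 Prop. 2.1 (proof), p. 144] -/
theorem expForm_transOperator_mem_invariantForms {α : Form F (k + 1)} (hα : α ∈ invariantForms (stabInfty Γ) (k + 1))
    (ℓ : (F →+* ℝ) → ℝ) :
    expForm (transOperator (imagVec ℓ) (logForm α)) ∈ invariantForms (stabInfty Γ) k := by
  have hΘ : ContDiff ℝ ∞ (logForm α) := contDiff_logForm hα.1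
  have hP : ContDiff ℝ ∞ (transOperator (imagVec ℓ) (logForm α)) := contDiff_transOperator _ hΘ
  refine ⟨contDiffOn_expForm hP, fun γ hγ z hz ↦ ?_, fun z hz ↦ expForm_of_not_mem _ hz⟩
  obtain ⟨e, -, -, hγe⟩ := exists_eq_upperTri_of_apply_one_zero ((mem_stabInfty_iff Γ γ).1 hγ).2
  have hmem : upperTri e (γ 0 1) ∈ stabInfty Γ := hγe ▸ hγ
  -- `P_{iℓ}(Θ^*α)` is `logAct`-invariant
  have hinv : pullForm (logAct e (γ 0 1)) (transOperator (imagVec ℓ) (logForm α)) =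
      transOperator (imagVec ℓ) (logForm α) := by
    rw [logAct_eq_add, ← transOperator_pullForm_affine (logActL_imagVec e ℓ) _ hΘ.continuous, ← logAct_eq_add,
      pullForm_logAct_logForm hα.2.1 hmem]
  -- `Θ⁻¹ ∘ γ = logAct ∘ Θ⁻¹` near `z`
  have hγz : moeb γ z ∈ halfSpace F := moeb_mem_halfSpace γ hz
  have hev : (logIm ∘ moeb γ : Point F → Point F) =ᶠ[𝓝 z] (logAct e (γ 0 1) ∘ logIm) := by
    filter_upwards [isOpen_halfSpace.mem_nhds hz] with y hy
    simp only [Function.comp_apply]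
    conv_lhs => rw [hγe, ← expIm_logIm hy, moeb_upperTri_expIm, logIm_expIm]
  have hD : (fderiv ℝ logIm (moeb γ z)).comp (fderiv ℝ (moeb γ) z) = (logActL e).comp (fderiv ℝ logIm z) := by
    rw [← fderiv_comp z (differentiableAt_logIm hγz) ((hasFDerivAt_moeb γ hz).restrictScalars ℝ).differentiableAt,
      hev.fderiv_eq, fderiv_comp z (hasFDerivAt_logAct e _ _).differentiableAt (differentiableAt_logIm hz), fderiv_logAct]
  have hpt : logIm (moeb γ z) = logAct e (γ 0 1) (logIm z) := hev.self_of_nhds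
  have hDv : ∀ u : Point F, fderiv ℝ logIm (moeb γ z) (fderiv ℝ (moeb γ) z u) = logActL e (fderiv ℝ logIm z u) := fun u ↦
    congrArg (fun T : Point F →L[ℝ] Point F ↦ T u) hD
  rw [moebPullback_def, expForm_of_mem _ hγz, expForm_of_mem _ hz]
  ext v
  have key' := congrArg (fun Ψ : Form F k ↦ Ψ (logIm z) fun i ↦ fderiv ℝ logIm z (v i)) hinv
  simp only [pullForm_apply, fderiv_logAct] at key'
  simp only [ContinuousAlternatingMap.compContinuousLinearMap_apply, Function.comp_def, hDv, hpt]
  exact key'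

/-- **The theorem: `δ_ℓ^*ω − ω = d η_ℓ` on `ℂ^{Hom(F,ℝ)}` with `η_ℓ = (Θ⁻¹)^* P_{iℓ}(Θ^*ω)`, for every closed `Γ_∞`-invariant
`(k+1)`-form `ω`** (in the coordinates `w`: `Θ^*ω(· + iℓ) − Θ^*ω = d P_{iℓ}(Θ^*ω)`, the tree's `sub_eq_extDeriv_transOperator`,
transported back by `Θ⁻¹`; `D(Θ ∘ τ_{iℓ} ∘ Θ⁻¹) = δ_ℓ` since `Θ ∘ τ_{iℓ} ∘ Θ⁻¹ = δ_ℓ` is linear).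
[cite: BottTu1982Forms, §I.4 Cor. 4.1.2; Freitag1990, Ch. III §2 Prop. 2.1 (proof: «`Hⁿ/Γ_∞ ≈ (D/Γ_∞) × ℝ`»), p. 144] -/
theorem dilPullback_sub_eq_extD {α : Form F (k + 1)} (hα : α ∈ closedForms (stabInfty Γ) (k + 1))
    (ℓ : (F →+* ℝ) → ℝ) :
    dilPullback ℓ α - α = extD (expForm (transOperator (imagVec ℓ) (logForm α))) := by
  have hinv : α ∈ invariantForms (stabInfty Γ) (k + 1) := ((mem_closedForms_iff _ _).1 hα).1
  have hΘ : ContDiff ℝ ∞ (logForm α) := contDiff_logForm hinv.1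
  have hcl : extDeriv (logForm α) = 0 := extDeriv_logForm_eq_zero hα
  have hP : ContDiff ℝ ∞ (transOperator (imagVec ℓ) (logForm α)) := contDiff_transOperator _ hΘ
  funext z
  by_cases hz : z ∈ halfSpace F
  · rw [extD_expForm hP, Pi.sub_apply, expForm_of_mem _ hz,
      ← sub_eq_extDeriv_transOperator (imagVec ℓ) hΘ hcl (logIm z)]
    have h2 : (logForm α (logIm z)).compContinuousLinearMap (fderiv ℝ logIm z) = α z :=
      pullForm_logIm_logForm α hz
    have hD : (fderiv ℝ expIm (logIm z + imagVec ℓ)).comp (fderiv ℝ logIm z) = dilateL ℓ := by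
      have hev : (expIm ∘ fun y ↦ logIm y + imagVec ℓ) =ᶠ[𝓝 z] (dilateL ℓ : Point F → Point F) := by
        filter_upwards [isOpen_halfSpace.mem_nhds hz] with y hy
        simp only [Function.comp_apply]
        rw [expIm_add_imagVec, expIm_logIm hy]
      have hc : HasFDerivAt (expIm ∘ fun y ↦ logIm y + imagVec ℓ)
          ((fderiv ℝ expIm (logIm z + imagVec ℓ)).comp (fderiv ℝ logIm z)) z :=
        (differentiable_expIm (logIm z + imagVec ℓ)).hasFDerivAt.comp z
          ((differentiableAt_logIm hz).hasFDerivAt.add_const (imagVec ℓ))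
      rw [← hc.fderiv, hev.fderiv_eq, (dilateL ℓ).fderiv]
    have h1 : (logForm α (logIm z + imagVec ℓ)).compContinuousLinearMap (fderiv ℝ logIm z) = dilPullback ℓ α z := by
      rw [dilPullback_of_mem _ _ hz, logForm_apply_eq, expIm_add_imagVec, expIm_logIm hz]
      ext v
      simp only [ContinuousAlternatingMap.compContinuousLinearMap_apply, Function.comp_def]
      congr 1
      funext i
      exact congrArg (fun T : Point F →L[ℝ] Point F ↦ T (v i)) hD
    rw [← h1, ← h2]
    ext v
    simp [ContinuousAlternatingMap.compContinuousLinearMap_apply]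
  · rw [Pi.sub_apply, extD_of_not_mem _ hz, dilPullback_of_not_mem _ _ hz, hinv.2.2 z hz, sub_zero]

/-- **`δ_ℓ^*ω − ω ∈ B^{k+1}((ℍⁿ, Γ_∞))` for every `ω ∈ C^{k+1}((ℍⁿ, Γ_∞))` and every `ℓ`.** [cite: BottTu1982Forms, §I.4 Cor. 4.1.2;
Freitag1990, Ch. III §2 Prop. 2.1 (proof), p. 144] -/
theorem dilPullback_sub_mem_exactForms {α : Form F (k + 1)} (hα : α ∈ closedForms (stabInfty Γ) (k + 1))
    (ℓ : (F →+* ℝ) → ℝ) : dilPullback ℓ α - α ∈ exactForms (stabInfty Γ) (k + 1) := by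
  rw [dilPullback_sub_eq_extD hα ℓ, mem_exactForms_succ_iff]
  exact ⟨_, expForm_transOperator_mem_invariantForms ((mem_closedForms_iff _ _).1 hα).1 ℓ, rfl⟩

/-- **`δ_ℓ^*ω ∈ C^{k+1}((ℍⁿ, Γ_∞))`** (it is `ω` plus an exact form). [cite: Freitag1990, Ch. III §2, pp. 143–144] -/
theorem dilPullback_mem_closedForms {α : Form F (k + 1)} (hα : α ∈ closedForms (stabInfty Γ) (k + 1))
    (ℓ : (F →+* ℝ) → ℝ) : dilPullback ℓ α ∈ closedForms (stabInfty Γ) (k + 1) := by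
  have h := Submodule.add_mem _ (exactForms_le_closedForms _ _ (dilPullback_sub_mem_exactForms hα ℓ)) hα
  rwa [sub_add_cancel] at h

/-- **The dilations act trivially on `H^{k+1}((ℍⁿ, Γ_∞))`: `[δ_ℓ^*ω] = [ω]`.** [cite: BottTu1982Forms, §I.4 Cor. 4.1.2 (homotopic maps
induce the same map in cohomology); Freitag1990, Ch. III §2 Prop. 2.1 (proof), p. 144] -/
theorem mk_dilPullback_eq (α : closedForms (stabInfty Γ) (k + 1)) (ℓ : (F →+* ℝ) → ℝ) :
    deRhamCohomology.mk (stabInfty Γ) (k + 1) ⟨dilPullback ℓ α, dilPullback_mem_closedForms α.2 ℓ⟩ =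
      deRhamCohomology.mk (stabInfty Γ) (k + 1) α :=
  (deRhamCohomology.mk_eq_mk_iff _ _ _).2 (dilPullback_sub_mem_exactForms α.2 ℓ)

/-- **In particular for the flow `φ_r` of `…TopDegreeVanishing`: `[φ_r^*ω] = [ω]` in every positive degree.**
[cite: Freitag1990, Ch. III §2 Prop. 2.1 (proof), p. 144; BottTu1982Forms, §I.4] -/
theorem imFlow_pullback_sub_mem_exactForms {α : Form F (k + 1)} (hα : α ∈ closedForms (stabInfty Γ) (k + 1)) (r : ℝ) :
    (halfSpace F).indicator (pullForm (imFlow r) α) - α ∈ exactForms (stabInfty Γ) (k + 1) := by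
  have h : (imFlow r : Point F → Point F) = dilateL (fun _ ↦ r) := funext fun z ↦ (dilateL_const_apply r z).symm
  rw [h]
  exact dilPullback_sub_mem_exactForms hα fun _ ↦ r

end Dilation

end Literature.NumberTheory.Automorphic.HilbertModular

end
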